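import Summits.QuantumFields.YangMills.Theorems.UnitScaleTiltProp7OneStepDefectSupportT3
import Summits.QuantumFields.YangMills.Theorems.UnitScaleTiltProp7GradBlindLocalCurlBound
import Summits.QuantumFields.YangMills.Theorems.UnitScaleTiltProp7SliceBoundBookkeeping
import HarnessLib

/-!
# `UnitScaleTiltProp7OneStepDefectERowT3` — (I3′) PLAN B, FILE P4-D «THE E-ROW»: the one-step defect is `ℓ²`-bounded by the curl energy of its level,
# `Σ_c ‖(linAvg − γ_j)(Y)(c)‖² ≤ K_E(L)·Σ_p ‖curl Y(p)‖²`, `K_E(L) = ((4d+6)L·d·(2L+(L−1)∕2))²·(d·3^d)` — w4's P1 ∘ px21's P2 support row ∘ a box-owner count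
(route `UnitScaleTilt`, crux K1 «MinimiserStabilityRegPr» stmt-QuantumFields-19200; route-R E′ (A′)-comb; ★★OWNER RULING №18 (2); PLAN B (px22 ac2baf06, adopted by w4 g8 05:54:26Z): P1 w4 ✓`Prop7GradBlindLocalCurlBound`,
P2 px21 ✓`Prop7OneStepDefect` + ✓`Prop7OneStepDefectSupport` (the (hW) row, w4 g9 06:41:25Z corner∕side `x₀ = blockSite c₋ 0`, `s = 2L + (L−1)∕2`, no wrap `j + 2 ≤ m + K`), P3 px22, P4 px6 (P4-A∕B∕C∕E); this file =
P4-D, the LAST displayed input of P4-C∕P4-E's `hE`; def-free, count-neutral).  Cell `ym3-torus` (HUMAN RULING D-0037, YM ladder rung R3 — YM₃ on T³ is a rung, not d = 4, not infinite volume, not a mass gap,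
not Clay), width seat `ym3-torus-px6` (gen 6).

THE PRINT.  [Balaban1985Averaging] (124)–(127) pp.36–37: the linearised averaging is a product of ONE-STEP maps; [Balaban1984PropagatorsI] (1.9) p.19: a gradient-blind local functional of a bond field is
controlled by the plaquette variables on its support (axial gauge + Stokes — w4's P1 ✓`normSq_le_of_gradBlind_local`).  Applied to the one-step defect `e_j = linAvg − γ_j` (gradient-blind: px21 ✓`oneStepDefect_grad`;
local with sup-control: px21 ✓`norm_oneStepDefect_le_of_box`; ℝ-linear: ✓`isLinearMap_oneStepDefect`) this gives, per coarse bond, `‖e_j Y c‖² ≤ (Wt·d·s)²·Σ_{p ∈ box(c)} ‖curl Y p‖²`; every level-`j`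
plaquette lies in at most `d·3^d` of the boxes (§1: the box corner is the label `L·c₋`, so `c₋ μ ∈ {⌊p₋ μ∕L⌋ − 2, ⌊p₋ μ∕L⌋ − 1, ⌊p₋ μ∕L⌋}`), hence the E-ROW (§2) by double counting (px6 ✓`sum_sum_le_mul_sum_of_card_le`).
WHAT IS PROVED (sorry-free, no definition; any `Params P`): §1 ★`card_boxOwners_le (hj : j+1 ≤ m+K) (x) (hs : s ≤ 3L) : #{c : PBond P (j+1) | ∀ μ, (x μ − (blockSite c₋ 0) μ).val < s} ≤ d·3^d`;
§2 ★★★`eRow (hj2 : j + 2 ≤ m + K) (Y) (e) (he : ∀ c, e c = linAvg Y c − γ_j Y c) : Σ_c ‖e c‖² ≤ K_E·Σ_p ‖curl 1 Y p‖²` and the tower form ★★★`eRow_tower (hk : k + 1 ≤ m + K) : ∀ j < k, …` —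
EXACTLY the hypothesis `hE` of px6 ✓`sum_norm_sq_defect_le_of_eRow` ∕ `hT_of_eRow` ∕ `hN06_at_one_of_eRow` (there `k = K − n`, `(F.P K).m = F.m ≥ 1`).
HONEST FRAMING.  A composition of landed rows with one counting lemma; crude L-only constant; nothing of N06 at curved `W`, HESS, E′, EX or the crux K1 is proved or claimed.  Rung R3, not Clay;
YM gap NOT proved.  `--supports stmt-QuantumFields-19200 --as helper`.
References: T. Bałaban, CMP 98 (1985) 17–51 [Balaban1985Averaging] ((124)–(127) pp.36–37); CMP 95 (1984) 17–40 [Balaban1984PropagatorsI] ((1.9) p.19, (1.11) p.19); CMP 109 (1987) 249–301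
[Balaban1987RG1] ((0.3) p.252); CMP 99 (1985) 389–434 [Balaban1985BackgroundPropagators] (Thm 3.11 p.416).
-/

noncomputable section
open scoped BigOperators Matrix.Norms.L2Operator

namespace Summit.QuantumFields.YangMills.Theorems.Prop7OneStepDefectERow

open Literature.MathematicalPhysics.QuantumFieldTheory.Balaban1983to89
open B7Prop1Explicit (boxVec treeWord)
open B10Eq27TorusAxialLog (transl)
open T4Continuum BlockAveraging LatticeFieldCalculus
open BlockAveragingEMLLinearised (walkSum linAvg)
open Summit.QuantumFields.YangMills.Theorems.Prop7OneStepDefect (oneStepDefect_grad)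
open Summit.QuantumFields.YangMills.Theorems.Prop7OneStepDefectSupport (norm_oneStepDefect_le_of_box boxSide_succ_le_sitesPerDir isLinearMap_oneStepDefect)
open Summit.QuantumFields.YangMills.Theorems.Prop7GradBlindLocalCurlBound (normSq_le_of_gradBlind_local)
open Summit.QuantumFields.YangMills.Theorems.Prop7SliceBoundBookkeeping (sum_sum_le_mul_sum_of_card_le)

variable {P : Params} {j : ℕ}

/-! ## §1 Every level-`j` site lies in at most `d·3^d` of the boxes `L·c₋ + [0, s)^d`, `s ≤ 3L` -/

/-- ★ **THE BOX-OWNER COUNT**: for `s ≤ 3L`, a level-`j` site `x` lies in the box `{z : ∀ μ, (z μ − (blockSite c₋ 0) μ).val < s}` of at most `d·3^d` coarse bonds `c` — the corner label is `L·(c₋ μ)`,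
so `c₋ μ = ⌊…⌋ − t_μ` with `t_μ := ⌊(x μ − L·c₋ μ).val ∕ L⌋ ∈ {0,1,2}`, and `c ↦ (t, dir c)` is injective (standing range `j + 1 ≤ m + K`: `N_j = L·N_{j+1}`).
[cite: Balaban1987RG1, (0.3) p.252; Balaban1984PropagatorsI, (1.11) p.19] -/
theorem card_boxOwners_le (hj : j + 1 ≤ P.m + P.K) (x : Site P j) {s : ℕ} (hs : s ≤ 3 * P.L) :
    (Finset.univ.filter fun c : PBond P (j + 1) => ∀ μ, (x μ - (Site.blockSite c.src (fun _ => ⟨0, P.L_pos⟩)) μ).val < s).card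
      ≤ P.d * 3 ^ P.d := by
  classical
  have hL0 : 0 < P.L := P.L_pos
  -- the label of the box corner and the offset `δ`
  have hb : ∀ (c : PBond P (j + 1)) (μ : Fin P.d),
      (Site.blockSite c.src (fun _ => (⟨0, P.L_pos⟩ : Fin P.L))) μ = (((c.src μ).val * P.L : ℕ) : ZMod (P.sitesPerDir j)) := by
    intro c μ
    simp only [Site.blockSite, add_zero]
  let δ : PBond P (j + 1) → Fin P.d → ℕ := fun c μ => (x μ - (Site.blockSite c.src (fun _ => ⟨0, P.L_pos⟩)) μ).val
  let t : PBond P (j + 1) → (Fin P.d → Fin 3) := fun c μ => ⟨min (δ c μ / P.L) 2, by omega⟩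
  -- the reading `c ↦ (t c, dir c)` is injective on the box owners
  have hN : P.sitesPerDir j = P.sitesPerDir (j + 1) * P.L := P.sitesPerDir_eq_mul_succ hj
  have key : ∀ c c' : PBond P (j + 1), (∀ μ, δ c μ < s) → (∀ μ, δ c' μ < s) → t c = t c' → c.dir = c'.dir → c = c' := by
    intro c c' hc hc' ht hdir
    have hsrc : c.src = c'.src := by
      funext μ
      have hδ : δ c μ < 3 * P.L := lt_of_lt_of_le (hc μ) hs
      have hδ' : δ c' μ < 3 * P.L := lt_of_lt_of_le (hc' μ) hs
      have hq : δ c μ / P.L < 3 := by rwa [Nat.div_lt_iff_lt_mul hL0]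
      have hq' : δ c' μ / P.L < 3 := by rwa [Nat.div_lt_iff_lt_mul hL0]
      have htμ : δ c μ / P.L = δ c' μ / P.L := by
        have h1 := congrArg (fun f => ((f μ : Fin 3) : ℕ)) ht
        simp only [t] at h1
        rwa [min_eq_left (by omega), min_eq_left (by omega)] at h1
      -- `x μ = L·y + δ = L·y′ + δ′` in `ZMod N_j`
      have e1 : ((((c.src μ).val * P.L + δ c μ : ℕ)) : ZMod (P.sitesPerDir j)) = x μ := by
        rw [Nat.cast_add, ← hb c μ]
        simp only [δ, ZMod.natCast_zmod_val, add_sub_cancel]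
      have e2 : ((((c'.src μ).val * P.L + δ c' μ : ℕ)) : ZMod (P.sitesPerDir j)) = x μ := by
        rw [Nat.cast_add, ← hb c' μ]
        simp only [δ, ZMod.natCast_zmod_val, add_sub_cancel]
      have hmod : (c.src μ).val * P.L + δ c μ ≡ (c'.src μ).val * P.L + δ c' μ [MOD P.sitesPerDir j] :=
        (ZMod.natCast_eq_natCast_iff _ _ _).1 (e1.trans e2.symm)
      -- mod `L`: the fine offsets agree, hence `δ = δ′`
      have hmodL : (c.src μ).val * P.L + δ c μ ≡ (c'.src μ).val * P.L + δ c' μ [MOD P.L] :=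
        Nat.ModEq.of_dvd (by rw [hN]; exact Dvd.intro_left _ rfl) hmod
      have hr : δ c μ % P.L = δ c' μ % P.L := by
        have h1 : ((c.src μ).val * P.L + δ c μ) % P.L = δ c μ % P.L := by rw [Nat.add_comm, Nat.add_mul_mod_self_right]
        have h2 : ((c'.src μ).val * P.L + δ c' μ) % P.L = δ c' μ % P.L := by rw [Nat.add_comm, Nat.add_mul_mod_self_right]
        rw [← h1, ← h2]; exact hmodL
      have hδeq : δ c μ = δ c' μ := by
        rw [← Nat.div_add_mod (δ c μ) P.L, ← Nat.div_add_mod (δ c' μ) P.L, htμ, hr]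
      -- hence `L·y ≡ L·y′ (mod L·N_{j+1})`, so `y ≡ y′ (mod N_{j+1})`
      rw [hδeq] at hmod
      have hmod2 : (c.src μ).val * P.L ≡ (c'.src μ).val * P.L [MOD P.sitesPerDir (j + 1) * P.L] := by
        rw [← hN]; exact Nat.ModEq.add_right_cancel' _ hmod
      have hmod3 : (c.src μ).val ≡ (c'.src μ).val [MOD P.sitesPerDir (j + 1)] := Nat.ModEq.mul_right_cancel' hL0.ne' hmod2
      have := (ZMod.natCast_eq_natCast_iff _ _ _).2 hmod3
      rwa [ZMod.natCast_zmod_val, ZMod.natCast_zmod_val] at this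
    cases c; cases c'
    simp only at hsrc hdir
    subst hsrc hdir
    rfl
  -- count through the injection into `(Fin d → Fin 3) × Fin d`
  have hcard : (Finset.univ.filter fun c : PBond P (j + 1) => ∀ μ, δ c μ < s).card ≤ (Finset.univ : Finset ((Fin P.d → Fin 3) × Fin P.d)).card := by
    refine Finset.card_le_card_of_injOn (fun c => (t c, c.dir)) (fun c _ => Finset.mem_univ _) ?_
    intro c hc c' hc' h
    simp only [Finset.coe_filter, Finset.mem_univ, true_and, Set.mem_setOf_eq] at hc hc'
    simp only [Prod.mk.injEq] at h
    exact key c c' hc hc' h.1 h.2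
  rw [Finset.card_univ, Fintype.card_prod, Fintype.card_fun, Fintype.card_fin, Fintype.card_fin] at hcard
  simpa [δ, mul_comm] using hcard

/-! ## §2 ★★★ The E-ROW -/

section ERow

variable {n : Type*} [Fintype n] [DecidableEq n]

/-- ★★★ **THE E-ROW — THE ONE-STEP DEFECT IS `ℓ²`-BOUNDED BY THE CURL ENERGY OF ITS LEVEL**: at every level `j` with `j + 2 ≤ m + K` (no wrap of the `(2.5L)`-box), for `e c = linAvg Y c − γ_j Y c`
(px21's cornered letter): `Σ_{c : PBond P (j+1)} ‖e c‖² ≤ ((4d+6)L·(d·(2L+(L−1)∕2)))²·(d·3^d)·Σ_{p : Plaq P j} ‖curl 1 Y p‖²` — per `c` w4's P1 ✓`normSq_le_of_gradBlind_local` at px21's (hW)∕(hblind)∕linearity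
(the composed term px21 kernel-verified), then the box-owner count and double counting. [cite: Balaban1985Averaging, (124)–(127) pp.36–37; Balaban1984PropagatorsI, (1.9) p.19, (1.11) p.19; Balaban1987RG1, (0.3) p.252] -/
theorem eRow (hj2 : j + 2 ≤ P.m + P.K) (Y : PBond P j → Matrix n n ℂ) (e : PBond P (j + 1) → Matrix n n ℂ)
    (he : ∀ c : PBond P (j + 1), e c = linAvg Y c
        - ( ((((P.L : ℝ)) ^ P.d)⁻¹) • ∑ r : Fin P.d → Fin P.L, segSum Y (transl (emb c.src) (boxVec P.L r)) c.dir P.L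
            - ( ((((P.L : ℝ)) ^ P.d)⁻¹) • ∑ r : Fin P.d → Fin P.L, walkSum Y (walk (emb c.tgt) (treeWord (boxVec P.L r)))
              - ((((P.L : ℝ)) ^ P.d)⁻¹) • ∑ r : Fin P.d → Fin P.L, walkSum Y (walk (emb c.src) (treeWord (boxVec P.L r))) ) )) :
    ∑ c : PBond P (j + 1), ‖e c‖ ^ 2
      ≤ (((((4 * P.d + 6) * P.L : ℕ) : ℝ) * ((P.d : ℝ) * ((2 * P.L + (P.L - 1) / 2 : ℕ) : ℝ))) ^ 2 * ((P.d * 3 ^ P.d : ℕ) : ℝ))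
        * ∑ p : Plaq P j, ‖curl 1 Y p‖ ^ 2 := by
  classical
  have hj : j + 1 ≤ P.m + P.K := by omega
  -- per coarse bond: P1 at px21's support row
  have hper : ∀ c : PBond P (j + 1), ‖e c‖ ^ 2 ≤ ((((4 * P.d + 6) * P.L : ℕ) : ℝ) * ((P.d : ℝ) * ((2 * P.L + (P.L - 1) / 2 : ℕ) : ℝ))) ^ 2
      * ∑ p ∈ Finset.univ.filter (fun p : Plaq P j => ∀ μ, (p.src μ - (Site.blockSite c.src (fun _ => ⟨0, P.L_pos⟩)) μ).val < 2 * P.L + (P.L - 1) / 2),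
          ‖curl 1 Y p‖ ^ 2 := by
    intro c
    rw [he c]
    exact normSq_le_of_gradBlind_local (IsLinearMap.mk' _ (isLinearMap_oneStepDefect c)) (Site.blockSite c.src (fun _ => ⟨0, P.L_pos⟩))
      (boxSide_succ_le_sitesPerDir hj2) (fun Y M hM => norm_oneStepDefect_le_of_box hj2 Y c hM) (fun g => oneStepDefect_grad g c) Y
  -- the box-owner count and double counting
  have hs3 : 2 * P.L + (P.L - 1) / 2 ≤ 3 * P.L := by omega
  have hcount : ∀ p : Plaq P j, (Finset.univ.filter fun c : PBond P (j + 1) =>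
      p ∈ Finset.univ.filter (fun p : Plaq P j => ∀ μ, (p.src μ - (Site.blockSite c.src (fun _ => ⟨0, P.L_pos⟩)) μ).val < 2 * P.L + (P.L - 1) / 2)).card
        ≤ P.d * 3 ^ P.d := by
    intro p
    have h := card_boxOwners_le hj p.src hs3
    refine le_trans (le_of_eq ?_) h
    congr 1
    ext c
    simp
  have hdc := sum_sum_le_mul_sum_of_card_le
    (fun c : PBond P (j + 1) => Finset.univ.filter (fun p : Plaq P j => ∀ μ, (p.src μ - (Site.blockSite c.src (fun _ => ⟨0, P.L_pos⟩)) μ).val < 2 * P.L + (P.L - 1) / 2))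
    (fun p : Plaq P j => ‖curl 1 Y p‖ ^ 2) (fun p => by positivity) hcount
  calc ∑ c : PBond P (j + 1), ‖e c‖ ^ 2
      ≤ ∑ c : PBond P (j + 1), ((((4 * P.d + 6) * P.L : ℕ) : ℝ) * ((P.d : ℝ) * ((2 * P.L + (P.L - 1) / 2 : ℕ) : ℝ))) ^ 2
          * ∑ p ∈ Finset.univ.filter (fun p : Plaq P j => ∀ μ, (p.src μ - (Site.blockSite c.src (fun _ => ⟨0, P.L_pos⟩)) μ).val < 2 * P.L + (P.L - 1) / 2),
              ‖curl 1 Y p‖ ^ 2 := Finset.sum_le_sum fun c _ => hper c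
    _ = ((((4 * P.d + 6) * P.L : ℕ) : ℝ) * ((P.d : ℝ) * ((2 * P.L + (P.L - 1) / 2 : ℕ) : ℝ))) ^ 2
          * ∑ c : PBond P (j + 1), ∑ p ∈ Finset.univ.filter (fun p : Plaq P j => ∀ μ, (p.src μ - (Site.blockSite c.src (fun _ => ⟨0, P.L_pos⟩)) μ).val < 2 * P.L + (P.L - 1) / 2),
              ‖curl 1 Y p‖ ^ 2 := by rw [Finset.mul_sum]
    _ ≤ ((((4 * P.d + 6) * P.L : ℕ) : ℝ) * ((P.d : ℝ) * ((2 * P.L + (P.L - 1) / 2 : ℕ) : ℝ))) ^ 2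
          * (((P.d * 3 ^ P.d : ℕ) : ℝ) * ∑ p : Plaq P j, ‖curl 1 Y p‖ ^ 2) := mul_le_mul_of_nonneg_left hdc (by positivity)
    _ = _ := by ring

/-- ★★★ **THE E-ROW ALONG A TOWER OF HEIGHT `k`, `k + 1 ≤ m + K`** — EXACTLY the hypothesis `hE` of px6 ✓`Prop7SliceBoundOneStep.sum_norm_sq_defect_le_of_eRow` ∕ `Prop7SliceBoundOneStepMember.hT_of_eRow` ∕
`hN06_at_one_of_eRow` (there `P = F.P K`, `k = K − n ≤ K`, `(F.P K).m = F.m ≥ 1`). [cite: Balaban1985Averaging, (124)–(127) pp.36–37; Balaban1984PropagatorsI, (1.9) p.19] -/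
theorem eRow_tower {k : ℕ} (hk : k + 1 ≤ P.m + P.K) :
    ∀ (j : ℕ), j < k → ∀ (Y : PBond P j → Matrix n n ℂ) (e : PBond P (j + 1) → Matrix n n ℂ),
      (∀ c : PBond P (j + 1), e c = linAvg Y c
        - ( ((((P.L : ℝ)) ^ P.d)⁻¹) • ∑ r : Fin P.d → Fin P.L, segSum Y (transl (emb c.src) (boxVec P.L r)) c.dir P.L
            - ( ((((P.L : ℝ)) ^ P.d)⁻¹) • ∑ r : Fin P.d → Fin P.L, walkSum Y (walk (emb c.tgt) (treeWord (boxVec P.L r)))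
              - ((((P.L : ℝ)) ^ P.d)⁻¹) • ∑ r : Fin P.d → Fin P.L, walkSum Y (walk (emb c.src) (treeWord (boxVec P.L r))) ) )) →
      ∑ c : PBond P (j + 1), ‖e c‖ ^ 2
        ≤ (((((4 * P.d + 6) * P.L : ℕ) : ℝ) * ((P.d : ℝ) * ((2 * P.L + (P.L - 1) / 2 : ℕ) : ℝ))) ^ 2 * ((P.d * 3 ^ P.d : ℕ) : ℝ))
          * ∑ p : Plaq P j, ‖curl 1 Y p‖ ^ 2 :=
  fun j hj Y e he => eRow (by omega) Y e he

end ERow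

end Summit.QuantumFields.YangMills.Theorems.Prop7OneStepDefectERow

end
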